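import Summits.PneNP.PneNP.Theses.Feige

/-!
# Route Feige — `Assembly` (stmt-PneNP-10872)

`Assembly := SatMemNPCook → FirstMomentUnsat → FeigeThesis → PneNP`: the cruxes-to-summit composition of route Feige, which is exactly the route's
deciding theorem `Summit.PneNP.PneNP.Theses.Feige.closes` (planner-authored, elaborated with the route file) applied to the
same hypotheses. This file imports only the route file (cone hygiene).
-/

set_option linter.dupNamespace false -- `Summit.PneNP.PneNP.…`: summit = sub-problem name (D-0017 single-conjunct layout)

namespace Summit.PneNP.PneNP.Theorems

/-- **Assembly item of route Feige (stmt-PneNP-10872)**: `SatMemNPCook → FirstMomentUnsat → FeigeThesis → PneNP`, by the route's deciding theorem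
`Feige.closes`. [folklore] -/
theorem feige_assembly_proof : Summit.PneNP.PneNP.Theses.Feige.Assembly := by
  unfold Summit.PneNP.PneNP.Theses.Feige.Assembly
  exact fun hS hF hT => Summit.PneNP.PneNP.Theses.Feige.closes hT hS hF

end Summit.PneNP.PneNP.Theorems
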